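import Summits.CriticalPhenomena.CardyFormulaZ2.Theses.CardyWickAnisotropy
import Summits.CriticalPhenomena.CardyFormulaZ2.Theorems.CardyWickAnisotropyVitaliStep
import Summits.CriticalPhenomena.CardyFormulaZ2.Theorems.CardyWickAnisotropyRealAxisDictionary
import HarnessLib

/-!
# Crux `CardyWickAnisotropy.AnisotropicBoxCardy` (stmt-CriticalPhenomena-14309), line `birth`:
# near-square aspect ratios from normality on a SMALL disc

Lead c3 (2026-08-17).  The route's two-layer plan foresees the split
`DiscNormality ⇐ SmallDiscNormality → AnnulusExtension`, where `SmallDiscNormality` asks for a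
uniform bound of the complex-anisotropy crossing amplitudes `V n` on ONE closed disc
`‖2p - 1‖ ≤ ρ₀` (`0 < ρ₀ ≤ 1`) around the self-dual point instead of on every compact sub-disc of
`D = ball (1/2) (1/2)`.  This file records what the first half alone buys:

* `tendsto_of_norm_le_smallDisc_of_tendsto_iteratedDeriv` — the Vitali/Tannery step of
  `vitaliStep_proof` run on the small disc: entire `V n`, uniformly bounded on `‖2p - 1‖ ≤ ρ₀`,
  whose jets at `1/2` converge to those of `G` (holomorphic on `D`), converge to `G` pointwise on
  the open disc `‖z - 1/2‖ < ρ₀/2` (Cauchy's inequalities on a circle of radius `R < ρ₀/2`,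
  dominated convergence of the Taylor series);
* `anisotropicBoxCardy_nearSquare_of_smallDiscNormality_of_taylorIdentification` — hence
  `SmallDiscNormality(ρ₀) → TaylorIdentification → X_A(α)` for every `α ∈ (0, π)` whose critical
  weight is `ρ₀/2`-close to the square, `|2·criticalWeight (α/2) - 1| < ρ₀`: Cardy's value
  `Π_h (cot (α/2))` for the anisotropic self-dual boxes of every NEAR-SQUARE effective aspect ratio
  (an open set of `α` containing `π/2`, since `α ↦ criticalWeight (α/2)` is continuous with value
  `1/2` at `π/2`).  With `ρ₀ ↗ 1` along `DiscNormality` this is `vitaliStep_proof` again.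

So the annulus extension is needed only to reach ALL aspect ratios; the near-square window is
already decided by the small disc and the Taylor data at the square (both open: items 10255 / 14427).
-/

namespace Summit.CriticalPhenomena.CardyFormulaZ2.Theorems

open scoped Classical
open Filter Metric Complex Topology
open scoped Nat
open Summit.CriticalPhenomena.CardyFormulaZ2.Theses.CardyWickAnisotropy
  (TaylorIdentification RealAxisDictionary)

/-- **Pointwise convergence on a small disc from a uniform bound there and convergence of the jets
at the centre.**  If the `V n` are entire, uniformly bounded on the closed disc `‖2p - 1‖ ≤ ρ₀`
(`ρ₀ ≤ 1`), and all their derivatives at `1/2` converge to those of a function `G` holomorphic on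
`ball (1/2) (1/2)`, then `V n z → G z` for every `z` with `‖z - 1/2‖ < ρ₀/2` (Taylor expansion,
Cauchy's inequalities on the circle `‖p - 1/2‖ = R`, `‖z - 1/2‖ < R < ρ₀/2`, dominated convergence
of the series).  The case of all `ρ₀ < 1` is `tendsto_of_norm_le_of_tendsto_iteratedDeriv`. -/
theorem tendsto_of_norm_le_smallDisc_of_tendsto_iteratedDeriv {V : ℕ → ℂ → ℂ} {G : ℂ → ℂ}
    (hV : ∀ n, Differentiable ℂ (V n)) {ρ₀ : ℝ} (hρ₁ : ρ₀ ≤ 1)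
    (hN : ∃ C : ℝ, ∀ n : ℕ, ∀ p : ℂ, ‖2 * p - 1‖ ≤ ρ₀ → ‖V n p‖ ≤ C)
    (hG : DifferentiableOn ℂ G (ball ((1 : ℂ) / 2) (1 / 2)))
    (hT : ∀ k : ℕ, Tendsto (fun n : ℕ ↦ iteratedDeriv k (V n) ((1 : ℂ) / 2)) atTop
      (𝓝 (iteratedDeriv k G ((1 : ℂ) / 2))))
    {z : ℂ} (hz : ‖z - (1 : ℂ) / 2‖ < ρ₀ / 2) :
    Tendsto (fun n ↦ V n z) atTop (𝓝 (G z)) := by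
  set c : ℂ := (1 : ℂ) / 2 with hc
  obtain ⟨R, hzR, hR⟩ := exists_between hz
  have hR0 : 0 < R := lt_of_le_of_lt (norm_nonneg _) hzR
  obtain ⟨C, hC⟩ := hN
  have hzball : z ∈ ball c (1 / 2) := by
    rw [mem_ball_iff_norm]
    linarith
  -- Cauchy's inequalities on the circle of radius `R` about `c` (inside the bounded disc)
  have hcauchy : ∀ n k, ‖iteratedDeriv k (V n) c‖ ≤ k ! * C / R ^ k := by
    intro n k
    refine Complex.norm_iteratedDeriv_le_of_forall_mem_sphere_norm_le k hR0
      (hV n).diffContOnCl fun p hp ↦ hC n p ?_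
    rw [mem_sphere_iff_norm] at hp
    have h2 : 2 * p - 1 = 2 * (p - c) := by rw [hc]; ring
    rw [h2, norm_mul, hp, Complex.norm_ofNat]
    linarith
  -- Taylor expansions on the ball
  have hVsum : ∀ n, ∑' k, (k ! : ℂ)⁻¹ • (z - c) ^ k • iteratedDeriv k (V n) c = V n z :=
    fun n ↦ Complex.taylorSeries_eq_on_ball (hV n).differentiableOn hzball
  have hGsum : ∑' k, (k ! : ℂ)⁻¹ • (z - c) ^ k • iteratedDeriv k G c = G z :=
    Complex.taylorSeries_eq_on_ball hG hzball
  -- dominated convergence of the series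
  have key : Tendsto (fun n ↦ ∑' k, (k ! : ℂ)⁻¹ • (z - c) ^ k • iteratedDeriv k (V n) c) atTop
      (𝓝 (∑' k, (k ! : ℂ)⁻¹ • (z - c) ^ k • iteratedDeriv k G c)) := by
    refine tendsto_tsum_of_dominated_convergence (bound := fun k ↦ C * (‖z - c‖ / R) ^ k)
      ?_ ?_ ?_
    · exact (summable_geometric_of_lt_one (by positivity) ((div_lt_one hR0).2 hzR)).mul_left C
    · intro k
      exact ((hT k).const_smul _).const_smul _
    · refine Eventually.of_forall fun n k ↦ ?_
      have hk : (k ! : ℝ) ≠ 0 := by positivity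
      rw [norm_smul, norm_smul, norm_inv, norm_pow, Complex.norm_natCast]
      calc (k ! : ℝ)⁻¹ * (‖z - c‖ ^ k * ‖iteratedDeriv k (V n) c‖)
          ≤ (k ! : ℝ)⁻¹ * (‖z - c‖ ^ k * (k ! * C / R ^ k)) := by gcongr; exact hcauchy n k
        _ = C * (‖z - c‖ / R) ^ k := by rw [div_pow]; field_simp
  rw [← hGsum]
  exact key.congr fun n ↦ hVsum n

/-- Real-valued form of `tendsto_of_norm_le_smallDisc_of_tendsto_iteratedDeriv`: if moreover
`V n z` is the real number `x n` and `G z` is the real number `L`, then `x n → L`. -/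
theorem tendsto_real_of_norm_le_smallDisc_of_tendsto_iteratedDeriv {V : ℕ → ℂ → ℂ} {G : ℂ → ℂ}
    {x : ℕ → ℝ} {L : ℝ} {z : ℂ}
    (hV : ∀ n, Differentiable ℂ (V n)) {ρ₀ : ℝ} (hρ₁ : ρ₀ ≤ 1)
    (hN : ∃ C : ℝ, ∀ n : ℕ, ∀ p : ℂ, ‖2 * p - 1‖ ≤ ρ₀ → ‖V n p‖ ≤ C)
    (hG : DifferentiableOn ℂ G (ball ((1 : ℂ) / 2) (1 / 2)))
    (hT : ∀ k : ℕ, Tendsto (fun n : ℕ ↦ iteratedDeriv k (V n) ((1 : ℂ) / 2)) atTop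
      (𝓝 (iteratedDeriv k G ((1 : ℂ) / 2))))
    (hz : ‖z - (1 : ℂ) / 2‖ < ρ₀ / 2)
    (hx : ∀ n, V n z = ((x n : ℝ) : ℂ)) (hL : G z = ((L : ℝ) : ℂ)) :
    Tendsto x atTop (𝓝 L) := by
  have h := tendsto_of_norm_le_smallDisc_of_tendsto_iteratedDeriv hV hρ₁ hN hG hT hz
  rw [hL] at h
  have h2 : Tendsto (fun n ↦ ((x n : ℝ) : ℂ)) atTop (𝓝 ((L : ℝ) : ℂ)) := h.congr hx
  have h3 := (Complex.continuous_re.tendsto _).comp h2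
  simpa [Function.comp_def] using h3

/-- **Near-square aspect ratios from small-disc normality and the Taylor data at the square.**
If the complex-anisotropy crossing amplitudes `V n` of the self-dual boxes `[0,n+1]×[0,n]` are
uniformly bounded on one closed disc `‖2p - 1‖ ≤ ρ₀` (`ρ₀ ≤ 1`; the route's foreseen
`SmallDiscNormality`) and `TaylorIdentification` (stmt-CriticalPhenomena-14427) holds, then for every
`α ∈ (0, π)` with `|2·criticalWeight (α/2) - 1| < ρ₀` the `P_(𝕃(α))`-probability of a left–right
crossing of `[0,n+1]×[0,n]` tends to Cardy's value `Π_h (cot (α/2))` — the crux `AnisotropicBoxCardy`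
restricted to the near-square window decided by the small disc.  Proof: the local Vitali/Tannery
step at `z = criticalWeight (α/2)`, the real-axis dictionary (`realAxisDictionary_proof`) and the
prescribed values of the continuation `G`. -/
theorem anisotropicBoxCardy_nearSquare_of_smallDiscNormality_of_taylorIdentification
    {ρ₀ : ℝ} (hρ₁ : ρ₀ ≤ 1)
    (hN : let E : ℕ → Finset (Sym2 (Literature.Probability.LatticeModels.Site 2)) := fun n ↦ ((Literature.Probability.Percolation.rectangle (n + 1) n ×ˢ Literature.Probability.Percolation.rectangle (n + 1) n).filter (fun xy ↦ (Literature.Probability.LatticeModels.zdGraph 2).Adj xy.1 xy.2)).image (fun xy ↦ s(xy.1, xy.2)); let w : ℂ → Sym2 (Literature.Probability.LatticeModels.Site 2) → ℂ := fun p e ↦ if (∃ x y : Literature.Probability.LatticeModels.Site 2, e = s(x, y) ∧ x 1 = y 1) then p else 1 - p; let V : ℕ → ℂ → ℂ := fun n p ↦ ∑ ω ∈ (E n).powerset, (if ((ω : Set (Sym2 (Literature.Probability.LatticeModels.Site 2))) ∈ Literature.Probability.Percolation.lrCrossing (n + 1) n) then ∏ e ∈ E n, (if e ∈ ω then w p e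 else 1 - w p e) else 0); ∃ C : ℝ, ∀ n : ℕ, ∀ p : ℂ, ‖2 * p - 1‖ ≤ ρ₀ → ‖V n p‖ ≤ C)
    (hT : TaylorIdentification) :
    let P : ℝ → Sym2 (Literature.Probability.LatticeModels.Site 2) → unitInterval := fun α e ↦ if e ∈ (Literature.Probability.LatticeModels.zdGraph 2).edgeSet then (if (∃ x y : Literature.Probability.LatticeModels.Site 2, e = s(x, y) ∧ x 1 = y 1) then Literature.Probability.LatticeModels.criticalWeightI (α / 2) else Literature.Probability.LatticeModels.criticalWeightI ((Real.pi - α) / 2)) else 0; let PiH : ℝ → ℝ := fun r ↦ Literature.Probability.RandomPlanarGeometry.cardyFunction (((Literature.NumberTheory.EllipticCurves.JacobiThetaNull.theta2 (Complex.I * (r : ℂ)) / Literature.NumberTheory.EllipticCurves.JacobiThetaNull.theta3 (Complex.I * (r : ℂ))) ^ 4).re); ∀ α ∈ Set.Ioo (0:ℝ) Real.pi, |2 * Literature.Probability.LatticeModels.criticalWeight (α / 2) - 1| < ρ₀ → Filter.Tendsto (fun n : ℕ ↦ (Literature.Probability.LatticeModels.prodBernoulli (P α)).real (Literature.Probability.Percolation.lrCrossing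 (n + 1) n)) Filter.atTop (nhds (PiH (Real.cos (α / 2) / Real.sin (α / 2)))) := by
  have hU := realAxisDictionary_proof
  dsimp only [TaylorIdentification] at hT
  dsimp only [RealAxisDictionary] at hU
  dsimp only at hN ⊢
  intro α hα hclose
  obtain ⟨G, hG, hGval, hjet⟩ := hT
  have hz : ‖((Literature.Probability.LatticeModels.criticalWeight (α / 2) : ℝ) : ℂ) - (1 : ℂ) / 2‖
      < ρ₀ / 2 := by
    have hsub : ((Literature.Probability.LatticeModels.criticalWeight (α / 2) : ℝ) : ℂ) - (1 : ℂ) / 2 =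
        ((Literature.Probability.LatticeModels.criticalWeight (α / 2) - 1 / 2 : ℝ) : ℂ) := by
      push_cast; ring
    rw [hsub, Complex.norm_real, Real.norm_eq_abs]
    have h2 : |2 * Literature.Probability.LatticeModels.criticalWeight (α / 2) - 1| =
        2 * |Literature.Probability.LatticeModels.criticalWeight (α / 2) - 1 / 2| := by
      rw [show 2 * Literature.Probability.LatticeModels.criticalWeight (α / 2) - 1 =
          2 * (Literature.Probability.LatticeModels.criticalWeight (α / 2) - 1 / 2) by ring,
        abs_mul, abs_two]
    rw [h2] at hclose
    linarith
  refine tendsto_real_of_norm_le_smallDisc_of_tendsto_iteratedDeriv ?_ hρ₁ hN hG hjet hz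
    (hU α hα) (hGval α hα)
  -- each `V n` is a polynomial in `p`, hence entire (as in `vitaliStep_proof`)
  intro n
  refine Differentiable.fun_sum fun ω _ ↦ ?_
  by_cases hω : ((ω : Set (Sym2 (Literature.Probability.LatticeModels.Site 2))) ∈
      Literature.Probability.Percolation.lrCrossing (n + 1) n)
  · simp only [hω, ↓reduceIte]
    refine Differentiable.fun_finsetProd fun e _ ↦ ?_
    by_cases he : e ∈ ω <;>
      by_cases hh : (∃ x y : Literature.Probability.LatticeModels.Site 2, e = s(x, y) ∧ x 1 = y 1) <;>
      simp only [he, hh, ↓reduceIte] <;> fun_prop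
  · simp only [hω, ↓reduceIte]
    exact differentiable_const 0

end Summit.CriticalPhenomena.CardyFormulaZ2.Theorems
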